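import Mathlib
import Literature.Geometry.Lorentzian.PseudoRiemannianMetric
import Literature.Geometry.Lorentzian.LeviCivita
import Literature.Geometry.Lorentzian.EnergyCurrents
import Literature.Geometry.Lorentzian.Volume
import Literature.Geometry.Riemannian.RiemannianDistance
import HarnessLib

/-!
# ThreeShrinkerClassification

Topic `Literature/Geometry/Riemannian`. Named literature fact(s) relocated by the gate from `Summits/SmoothPoincare4/SmoothPoincare4/Theorems/EntropyRungNoncompactShrinkerGapStubThreeShrinkerGap.lean`
(accept-time relocation of `[cite]`d propositions written inline in a Summits proposal; human ruling 2026-08-15).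
Sources: CaoChenZhu2007, Ivey1993, MunteanuWang2016.

* `Literature.Geometry.Riemannian.threeShrinkerClassification_modelData`
-/

namespace Literature.Geometry.Riemannian

open scoped Manifold ContDiff ENNReal NNReal
open MeasureTheory Set
open Literature.Geometry.Lorentzian

/-- **Classification of complete three-dimensional gradient shrinking Ricci solitons — exported as
the model data of a normalised shrinker (named fact).** PRINTED THEOREMS. Munteanu–Wang,
arXiv:1606.01861 (= Ann. Sci. ÉNS 52 (2019)), Thm. 1.2 (p. 3): "A three dimensional gradient
shrinking Ricci soliton is isometric to the Euclidean space `ℝ³` or to a quotient of the sphere `S³`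
or of the cylinder `ℝ × S²`." (setting, p. 3: "a Riemannian manifold `(M, g)` is a gradient shrinking
Ricci soliton if there exists a smooth function `f ∈ C^∞(M)` such that … `Ric + Hess(f) = ½ g`",
completeness being the paper's standing assumption (abstract; p. 3, first sentence); history ibid.: "Ivey [I1] first showed that a three dimensional compact
gradient shrinking Ricci soliton must be a quotient of the sphere `S³`. … The noncollapsing assumption
was later removed by Naber [Na]. By adopting a different argument, Ni and Wallach [NW], and Cao,
Chen and Zhu [CCZ] showed the full classification result"; used verbatim in the proof of their
Thm. 5.1, p. 21, for a "normalized three dimensional gradient shrinking Ricci soliton" `(N, h)`: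
"isometric to a quotient of either `S³` or `ℝ × S²` … either `ℝ × S²` or its `ℤ₂` quotient").
Cao–Chen–Zhu, Surveys in Differential Geometry XII, Prop. 4.7 (p. 78): "Let `(M³, g_{ij})` be a
3-dimensional complete noncompact non-flat shrinking gradient soliton. Then `(M³, g_{ij})` is a
quotient of the round neck `S² × ℝ`." (proof: B.-L. Chen's Cor. 2.4 gives nonnegative sectional
curvature; `∇R = 2 Ric(∇f)`, `R + |∇f|² − f = Const` give quadratic curvature growth; then
Ni–Wallach), with the models listed in Lemma 4.6 (p. 77, Perelman): "(i) the round three-sphere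
`S³`, or its metric quotients; (ii) the round infinite cylinder `S² × ℝ`, or its `ℤ₂` quotients".
Ivey 1993, Thm. 1: a compact three-dimensional Ricci soliton has constant sectional curvature.
EXPORTED HERE — the tree has no finite Riemannian quotients `S³/Γ`, no product manifold `S² × ℝ`
with its product metric and no isometry classes of Riemannian manifolds, so the theorem is stated
through its immediate consequence for the data of a NORMALISED shrinker, over the binder used by
route `SmoothPoincare4/EntropyRung` for gradient shrinkers (`PseudoRiemannianMetric.ricci/hessian/
scalarCurvature/gradSq/edist`, `riemannianMeasure`): for `N` a connected `C^∞` 3-manifold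
(Hausdorff, second countable, charts in `ℝ³`), `h` a `C^∞` Riemannian metric on `TN` with its
Levi-Civita connection, complete (closed `h.edist`-balls compact), and `φ` smooth with
`Ric_h + Hess_h φ = ½ h` and `R_h + |∇φ|²_h = φ`, ONE of the following holds.
(o) [`ℝ³`, the Gaussian soliton] `R_h ≡ 0` and `∫_N e^{-φ} dV_h = (4π)^{3/2} = 8π√π`. Derivation:
`(N, h) ≅ ℝ³`, `Hess φ = ½ δ` gives `φ = |x − a|²/4 + c`, the normalisation `0 + |x − a|²/4 = φ`
gives `c = 0`, and `∫_{ℝ³} e^{-|x−a|²/4} dx = (4π)^{3/2}` (a flat quotient `ℝ³/Γ` carries no such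
`φ`: `Γ` would fix the minimum point `a`).
(a) [`S³/Γ`] `N` is compact, `R_h ≡ 3/2`, `φ ≡ 3/2` and `Vol_h(N) = 16π²/k` for an integer `k ≥ 1`.
Derivation: `(N, h) ≅ S³(r)/Γ`, `Γ ⊂ O(4)` finite of order `k` acting freely; `Ric = (2/r²) h`, so
`Hess φ = (½ − 2/r²) h` for the smooth `φ` on the closed manifold `N`, which at a maximum and at a
minimum point of `φ` forces `r = 2`, whence `Hess φ = 0` and `φ` is constant (`N` connected
compact); `R = 6/r² = 3/2`, `|∇φ| = 0`, and the normalisation gives `φ ≡ 3/2`;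
`Vol(S³(2)) = 2π² · 2³ = 16π²`, `Vol(S³(2)/Γ) = 16π²/k`. (So `∫_N e^{-φ} dV = 16π² e^{-3/2}/k`;
`k = 1` is the shrinking round sphere, `16π² e^{-3/2} = (4π)^{3/2} Θ₃(S³)`, Cao–Hamilton–Ilmanen
2004, §3.)
(b) [`S² × ℝ`] `R_h ≡ 1` and `∫_N e^{-φ} dV_h = 16π√π e^{-1}`. Derivation: `(N, h) ≅ S²(r) × ℝ`
(round times line); the mixed block of `Hess φ = ½ h − Ric = (½ − 1/r²) h_{S²} ⊕ ½ dz²` vanishes,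
so `φ = A(x) + B(z)`, and the trace of the `S²`-block integrates to `0 = 2(½ − 1/r²)·Area` over the
closed factor: `r² = 2`, `A` is constant, `B'' = ½`, i.e. `φ = (z − a)²/4 + c`; `R = 2/r² = 1`,
`|∇φ|² = (z − a)²/4`, normalisation `c = 1`; `∫ e^{-φ} = Area(S²(√2)) · e^{-1} · ∫_ℝ e^{-(z−a)²/4} dz
= 8π · e^{-1} · 2√π`.
(c) [`(S² × ℝ)/ℤ₂`] `R_h ≡ 1` and `∫_N e^{-φ} dV_h = 8π√π e^{-1}`. Derivation: `(N, h) ≅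
(S²(√2) × ℝ)/Γ`, `Γ ≠ 1` a group of isometries of the product acting freely and preserving the lifted
potential `φ̃ = (z − a)²/4 + 1` (case (b) on the cover), hence acting on the line through
`{id, z ↦ 2a − z}`; the elements acting trivially on the line act freely on `S²`, so form `1` or
`{±I}`; an element `(A, z ↦ 2a − z)` is free iff `A ∈ O(3)` has no fixed point on `S²`, and `A`, `−A`
are never both fixed-point free (one lies in `SO(3)`), so `|Γ| = 4` is impossible: `Γ = ℤ₂`
(generated by `(−I, id)`, i.e. `ℝP² × ℝ`, or by `(−I, z ↦ 2a − z)`), and the weighted volume of (b)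
halves.
Users take `(h3 : threeShrinkerClassification_modelData)`; first user: the conditional closing
`stub_threeShrinkerGap_of_classification` of the registered stub `stub_threeShrinkerGap` of line
`collapsed-ends-usc` of crux `EntropyRung.NoncompactShrinkerGap` (Summits/SmoothPoincare4), which needs
only `∫_N e^{-φ} dV ≤ 16π² e^{-3/2}` in cases (a)–(c).
-- TODO(general form): the isometric classification itself — `(N, h)` is isometric to `ℝ³`,
-- `S³(2)/Γ`, `S²(√2) × ℝ` or `(S²(√2) × ℝ)/ℤ₂` (needs these model spaces as Riemannian manifolds in
-- the tree: finite Riemannian quotients of `roundMetric`, product metrics, and `Vol(S³) = 2π²`,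
-- `∫_ℝ e^{-z²/4} dz = 2√π` for `riemannianMeasure`).
[cite: MunteanuWang2016, Thm 1.2 (p. 3); proof of Thm 5.1 (p. 21)]
[cite: CaoChenZhu2007, Prop 4.7 (p. 78) and Lemma 4.6 (p. 77)] [cite: Ivey1993, Thm 1]
[file Geometry/Riemannian/ThreeShrinkerClassification] -/
def threeShrinkerClassification_modelData : Prop :=
  ∀ (N : Type) [TopologicalSpace N] [T2Space N] [SecondCountableTopology N]
    [ChartedSpace (EuclideanSpace ℝ (Fin 3)) N] [IsManifold (𝓡 3) ∞ N] [ConnectedSpace N]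
    [T3Space N] [MeasurableSpace N] [BorelSpace N]
    (h : Literature.Geometry.Lorentzian.PseudoRiemannianMetric (𝓡 3) ∞ (EuclideanSpace ℝ (Fin 3))
      (TangentSpace (𝓡 3) : N → Type _)) [h.HasLeviCivita]
    (φ : N → ℝ) (hh : h.IsRiemannian),
    (∀ (x : N) (r : NNReal), IsCompact {y : N | h.edist hh x y ≤ r}) →
    ContMDiff (𝓡 3) 𝓘(ℝ, ℝ) ∞ φ →
    (∀ (x : N) (X Y : TangentSpace (𝓡 3) x),
      h.ricci x X Y + h.hessian φ x X Y = (1 / 2 : ℝ) * h.val x X Y) →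
    (∀ x : N, h.scalarCurvature x + h.gradSq φ x = φ x) →
    -- (o) the Gaussian soliton `ℝ³`
    ((∀ x : N, h.scalarCurvature x = 0) ∧
        ∫⁻ x, ENNReal.ofReal (Real.exp (-φ x))
            ∂(Literature.Geometry.Lorentzian.riemannianMeasure (h.toContMDiffRiemannianMetric hh)) =
          ENNReal.ofReal (8 * Real.pi * Real.sqrt Real.pi)) ∨
    -- (a) the round space forms `S³(2)/Γ`, `|Γ| = k`
    (CompactSpace N ∧ (∀ x : N, h.scalarCurvature x = 3 / 2) ∧ (∀ x : N, φ x = 3 / 2) ∧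
        ∃ k : ℕ, 0 < k ∧
          Literature.Geometry.Lorentzian.riemannianMeasure (h.toContMDiffRiemannianMetric hh)
              Set.univ = ENNReal.ofReal (16 * Real.pi ^ 2 / k)) ∨
    -- (b) the round cylinder `S²(√2) × ℝ`
    ((∀ x : N, h.scalarCurvature x = 1) ∧
        ∫⁻ x, ENNReal.ofReal (Real.exp (-φ x))
            ∂(Literature.Geometry.Lorentzian.riemannianMeasure (h.toContMDiffRiemannianMetric hh)) =
          ENNReal.ofReal (16 * Real.pi * Real.sqrt Real.pi * Real.exp (-1))) ∨
    -- (c) the `ℤ₂`-quotients of the round cylinder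
    ((∀ x : N, h.scalarCurvature x = 1) ∧
        ∫⁻ x, ENNReal.ofReal (Real.exp (-φ x))
            ∂(Literature.Geometry.Lorentzian.riemannianMeasure (h.toContMDiffRiemannianMetric hh)) =
          ENNReal.ofReal (8 * Real.pi * Real.sqrt Real.pi * Real.exp (-1)))

/-! ## Arithmetic of the model constants -/

end Literature.Geometry.Riemannian
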